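import Literature.Geometry.Lorentzian.AxisymmetricBlackHoleUniquenessProofs
import Literature.Geometry.Lorentzian.KillingHorizonShadowAlong
import Literature.Geometry.Manifold.MaximalIntegralCurve
import HarnessLib

/-!
# A local Killing field commuting with `T` preserves the Gram matrix `g(T,T), g(T,Y), g(Y,Y)`
along its integral curves

Local form of the tree's `IsKillingField.gram_apply_eq_of_isMIntegralCurve_right`
(`AxisymmetricBlackHoleUniquenessProofs.lean`, both fields global): here `T` is a global Killing
field of a `C^n` pseudo-Riemannian metric `g` (`n ≥ 1`), while `Y` is only a Killing field ON AN
OPEN SET `O` (`IsKillingFieldOn`, O'Neill 1983, Ch. 9, Def. 9.22 on the open submanifold `O`)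
with `[T, Y] = 0` at the points of `O`.  Then at every `x ∈ O` the derivatives along `Y x` of the
three scalar functions `g(T,T)`, `g(T,Y)`, `g(Y,Y)` vanish (metric compatibility,
`∇_T Y = ∇_Y T` from `[T, Y] = 0` and torsion-freeness, and the two Killing equations — the
computation of Chruściel–Costa 2008, §6.2–6.4 / Heusler 1996, Ch. 2, that the metric functions of
a space-time with two commuting Killing fields live on the orbit space), so the three functions
are constant along every integral curve of `Y` that stays in `O`.  Consequence used by the crux
`NonTrappingHawkingRigidity` (summit `FinalStateConjecture`, stub `stub_farAxialSeed`): the flow of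
a `T`-commuting local Killing field preserves the `T`-timelike region `{g(T,T) < 0}` — the region
where a stationary vacuum metric is real-analytic (Müller zum Hagen 1970) — and indeed each level
set of `g(T,T)`.

Everything here is proved; no definitions, no named facts.

## References
* B. O'Neill, *Semi-Riemannian geometry*, Academic Press 1983, Ch. 3, Thm. 3.11; Ch. 9,
  Def. 9.22, Prop. 9.25. [ONeillSemiRiemannian1983]
* P. T. Chruściel, J. L. Costa, Astérisque 321 (2008), arXiv:0806.0016, §6.2–6.4. [ChruscielCosta2008]
-/

noncomputable section

open Bundle Set Filter Function
open scoped Manifold ContDiff Topology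

namespace Literature.Geometry.Lorentzian

namespace PseudoRiemannianMetric

variable {E : Type*} [NormedAddCommGroup E] [NormedSpace ℝ E] [FiniteDimensional ℝ E]
  [CompleteSpace E] {H : Type*} [TopologicalSpace H] {I : ModelWithCorners ℝ E H}
  {M : Type*} [TopologicalSpace M] [ChartedSpace H M] [IsManifold I ∞ M] {n : ℕ∞ω} [Fact (1 ≤ n)]
  {g : PseudoRiemannianMetric I n E (TangentSpace I : M → Type _)} [g.HasLeviCivita]
  {T Y : Π x : M, TangentSpace I x} {O : Set M} {x : M}

/-! ### The three derivatives along `Y` vanish at the points of `O` -/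

/-- **`Y g(T,T) = 0` on `O`** for a global Killing field `T` and a Killing field `Y` on the open set
`O` with `[T, Y](x) = 0`: the derivative is `2 g(∇_Y T, T) = 2 g(∇_T Y, T)` (torsion-free,
`leviCivita_apply_comm_of_mlieBracket_eq_zero`), which vanishes by the Killing equation of `Y` at
`x`. Chruściel–Costa 2008, §6.4 (the norm `-V²` of the stationary field is a function on the orbit
space). [cite: ChruscielCosta2008, §6.4] -/
theorem IsKillingFieldOn.mvfderiv_val_self_self_eq_zero (hT : g.IsKillingField T)
    (hY : g.IsKillingFieldOn Y O) (hO : IsOpen O) (hx : x ∈ O)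
    (hTY : VectorField.mlieBracket I T Y x = 0) :
    mvfderiv I (fun y ↦ g.val y (T y) (T y)) x (Y x) = 0 := by
  have hLC : g.IsLeviCivita g.leviCivita := isLeviCivita_leviCivita_holds
  have hTd : MDiffAt (T% T) x := hT.mdifferentiableAt x
  have hYd : MDiffAt (T% Y) x := hY.mdifferentiableAt hO hx
  rw [hLC.2 hYd hTd hTd, ← leviCivita_apply_comm_of_mlieBracket_eq_zero hTd hYd hTY]
  exact hY.val_leviCivita_add hx (T x) (T x)

/-- **`Y g(T,Y) = 0` on `O`**: the derivative is `g(∇_Y T, Y) + g(T, ∇_Y Y) = g(∇_T Y, Y) + g(T, ∇_Y Y)`,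
the Killing equation of `Y` at `x` evaluated on `(T, Y)`. Chruściel–Costa 2008, §6.4.
[cite: ChruscielCosta2008, §6.4] -/
theorem IsKillingFieldOn.mvfderiv_val_apply_eq_zero (hT : g.IsKillingField T)
    (hY : g.IsKillingFieldOn Y O) (hO : IsOpen O) (hx : x ∈ O)
    (hTY : VectorField.mlieBracket I T Y x = 0) :
    mvfderiv I (fun y ↦ g.val y (T y) (Y y)) x (Y x) = 0 := by
  have hLC : g.IsLeviCivita g.leviCivita := isLeviCivita_leviCivita_holds
  have hTd : MDiffAt (T% T) x := hT.mdifferentiableAt x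
  have hYd : MDiffAt (T% Y) x := hY.mdifferentiableAt hO hx
  rw [hLC.2 hYd hTd hYd, ← leviCivita_apply_comm_of_mlieBracket_eq_zero hTd hYd hTY]
  exact hY.val_leviCivita_add hx (T x) (Y x)

omit [FiniteDimensional ℝ E] [CompleteSpace E] in
/-- **`Y g(Y,Y) = 0` on `O`**: the derivative is `2 g(∇_Y Y, Y)`, zero by the Killing equation of
`Y` (no commutation needed). O'Neill 1983, Ch. 9, Prop. 9.25. [cite: ONeillSemiRiemannian1983, Ch. 9, Prop. 9.25] -/
theorem IsKillingFieldOn.mvfderiv_val_apply_self_eq_zero [FiniteDimensional ℝ E] [CompleteSpace E]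
    (hY : g.IsKillingFieldOn Y O) (hO : IsOpen O) (hx : x ∈ O) :
    mvfderiv I (fun y ↦ g.val y (Y y) (Y y)) x (Y x) = 0 := by
  have hLC : g.IsLeviCivita g.leviCivita := isLeviCivita_leviCivita_holds
  have hYd : MDiffAt (T% Y) x := hY.mdifferentiableAt hO hx
  rw [hLC.2 hYd hYd hYd]
  exact hY.val_leviCivita_add hx (Y x) (Y x)

/-! ### Constancy along the integral curves of `Y` inside `O` -/

omit [FiniteDimensional ℝ E] [CompleteSpace E] [Fact (1 ≤ n)] [g.HasLeviCivita] [IsManifold I ∞ M] in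
/-- A scalar function whose derivative along `Y` vanishes at the points of `O` is constant along
every integral curve of `Y` on an open order-connected parameter set mapped into `O` (chain rule
along the curve and the mean value theorem). [folklore] -/
theorem apply_eq_apply_of_isMIntegralCurveOn_of_mvfderiv_eq_zero {f : M → ℝ}
    (hf : ∀ y ∈ O, MDiffAt f y) (h0 : ∀ y ∈ O, mvfderiv I f y (Y y) = 0) {γ : ℝ → M} {J : Set ℝ}
    (hJ : IsOpen J) (hJc : J.OrdConnected) (hγ : IsMIntegralCurveOn γ Y J) (hγO : MapsTo γ J O)
    {s t : ℝ} (hs : s ∈ J) (ht : t ∈ J) : f (γ s) = f (γ t) := by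
  refine apply_eq_apply_of_hasDerivAt_zero (f := fun u ↦ f (γ u)) hJc (fun u hu ↦ ?_) hs ht
  have hγu := hγ.hasMFDerivAt_of_isOpen hJ hu
  have hvel : velocity I γ u = Y (γ u) := by
    rw [velocity, hγu.mfderiv]
    exact one_smul ℝ _
  have h1 := hasDerivAt_comp_curve (hf _ (hγO hu)) hγu.mdifferentiableAt
  rw [hvel] at h1
  have h2 : mfderiv I 𝓘(ℝ, ℝ) f (γ u) (Y (γ u)) = 0 := h0 _ (hγO hu)
  rwa [h2] at h1

/-- **`g(T,T)` is constant along the integral curves of `Y` inside `O`.** For a global Killing field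
`T`, a Killing field `Y` on the open set `O` with `[T, Y] = 0` on `O`, and an integral curve `γ` of
`Y` on an open order-connected `J` with `γ(J) ⊆ O`: `g(T,T)(γ s) = g(T,T)(γ t)` for `s, t ∈ J`.
Chruściel–Costa 2008, §6.4. [cite: ChruscielCosta2008, §6.4] -/
theorem IsKillingFieldOn.val_self_self_apply_eq_of_isMIntegralCurveOn (hT : g.IsKillingField T)
    (hY : g.IsKillingFieldOn Y O) (hO : IsOpen O) (hTY : ∀ y ∈ O, VectorField.mlieBracket I T Y y = 0)
    {γ : ℝ → M} {J : Set ℝ} (hJ : IsOpen J) (hJc : J.OrdConnected) (hγ : IsMIntegralCurveOn γ Y J)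
    (hγO : MapsTo γ J O) {s t : ℝ} (hs : s ∈ J) (ht : t ∈ J) :
    g.val (γ s) (T (γ s)) (T (γ s)) = g.val (γ t) (T (γ t)) (T (γ t)) :=
  apply_eq_apply_of_isMIntegralCurveOn_of_mvfderiv_eq_zero
    (fun y _ ↦ g.mdifferentiableAt_val_apply (hT.mdifferentiableAt y) (hT.mdifferentiableAt y))
    (fun y hy ↦ hY.mvfderiv_val_self_self_eq_zero hT hO hy (hTY y hy)) hJ hJc hγ hγO hs ht

/-- **`g(T,Y)` is constant along the integral curves of `Y` inside `O`.** Chruściel–Costa 2008,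
§6.4. [cite: ChruscielCosta2008, §6.4] -/
theorem IsKillingFieldOn.val_self_apply_apply_eq_of_isMIntegralCurveOn (hT : g.IsKillingField T)
    (hY : g.IsKillingFieldOn Y O) (hO : IsOpen O) (hTY : ∀ y ∈ O, VectorField.mlieBracket I T Y y = 0)
    {γ : ℝ → M} {J : Set ℝ} (hJ : IsOpen J) (hJc : J.OrdConnected) (hγ : IsMIntegralCurveOn γ Y J)
    (hγO : MapsTo γ J O) {s t : ℝ} (hs : s ∈ J) (ht : t ∈ J) :
    g.val (γ s) (T (γ s)) (Y (γ s)) = g.val (γ t) (T (γ t)) (Y (γ t)) :=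
  apply_eq_apply_of_isMIntegralCurveOn_of_mvfderiv_eq_zero
    (fun y hy ↦ g.mdifferentiableAt_val_apply (hT.mdifferentiableAt y) (hY.mdifferentiableAt hO hy))
    (fun y hy ↦ hY.mvfderiv_val_apply_eq_zero hT hO hy (hTY y hy)) hJ hJc hγ hγO hs ht

/-- **`g(Y,Y)` is constant along the integral curves of `Y` inside `O`.** O'Neill 1983, Ch. 9,
Prop. 9.25. [cite: ONeillSemiRiemannian1983, Ch. 9, Prop. 9.25] -/
theorem IsKillingFieldOn.val_apply_apply_eq_of_isMIntegralCurveOn (hY : g.IsKillingFieldOn Y O)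
    (hO : IsOpen O) {γ : ℝ → M} {J : Set ℝ} (hJ : IsOpen J) (hJc : J.OrdConnected)
    (hγ : IsMIntegralCurveOn γ Y J) (hγO : MapsTo γ J O) {s t : ℝ} (hs : s ∈ J) (ht : t ∈ J) :
    g.val (γ s) (Y (γ s)) (Y (γ s)) = g.val (γ t) (Y (γ t)) (Y (γ t)) :=
  apply_eq_apply_of_isMIntegralCurveOn_of_mvfderiv_eq_zero
    (fun _ hy ↦ g.mdifferentiableAt_val_apply (hY.mdifferentiableAt hO hy) (hY.mdifferentiableAt hO hy))
    (fun _ hy ↦ hY.mvfderiv_val_apply_self_eq_zero hO hy) hJ hJc hγ hγO hs ht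

/-! ### Whole-line integral curves staying in `O`; preservation of the `T`-timelike region -/

/-- Whole-line form: for an integral curve `γ : ℝ → M` of `Y` contained in `O`,
`g(T,T)(γ s) = g(T,T)(γ 0)` for all `s`. Chruściel–Costa 2008, §6.4. [cite: ChruscielCosta2008, §6.4] -/
theorem IsKillingFieldOn.val_self_self_apply_eq_of_isMIntegralCurve (hT : g.IsKillingField T)
    (hY : g.IsKillingFieldOn Y O) (hO : IsOpen O) (hTY : ∀ y ∈ O, VectorField.mlieBracket I T Y y = 0)
    {γ : ℝ → M} (hγ : IsMIntegralCurve γ Y) (hγO : ∀ s, γ s ∈ O) (s : ℝ) :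
    g.val (γ s) (T (γ s)) (T (γ s)) = g.val (γ 0) (T (γ 0)) (T (γ 0)) :=
  hY.val_self_self_apply_eq_of_isMIntegralCurveOn hT hO hTY isOpen_univ ordConnected_univ
    (hγ.isMIntegralCurveOn univ) (fun s _ ↦ hγO s) (mem_univ s) (mem_univ 0)

/-- **The flow of a `T`-commuting local Killing field preserves the `T`-timelike region**: an
integral curve of `Y` inside `O` which starts at a point where `T` is timelike (`g(T,T) < 0`)
consists of such points; likewise for any strict or non-strict sign condition, `g(T,T)` being
constant along the curve. This is why the continuation of an axial Killing field along the region
where a stationary vacuum metric is real-analytic (`T` timelike, Müller zum Hagen 1970) is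
compatible with the saturation by its own flow. Chruściel–Costa 2008, §6.4. [cite: ChruscielCosta2008, §6.4] -/
theorem IsKillingFieldOn.val_self_self_neg_of_isMIntegralCurve (hT : g.IsKillingField T)
    (hY : g.IsKillingFieldOn Y O) (hO : IsOpen O) (hTY : ∀ y ∈ O, VectorField.mlieBracket I T Y y = 0)
    {γ : ℝ → M} (hγ : IsMIntegralCurve γ Y) (hγO : ∀ s, γ s ∈ O)
    (h0 : g.val (γ 0) (T (γ 0)) (T (γ 0)) < 0) (s : ℝ) :
    g.val (γ s) (T (γ s)) (T (γ s)) < 0 := by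
  rwa [hY.val_self_self_apply_eq_of_isMIntegralCurve hT hO hTY hγ hγO s]

/-- **Level sets of `g(T,T)` are invariant**: an integral curve of `Y` inside `O` stays in the level
set `{y | g(T,T)(y) = c}` of its starting point. Chruściel–Costa 2008, §6.4. [cite: ChruscielCosta2008, §6.4] -/
theorem IsKillingFieldOn.mem_levelSet_of_isMIntegralCurve (hT : g.IsKillingField T)
    (hY : g.IsKillingFieldOn Y O) (hO : IsOpen O) (hTY : ∀ y ∈ O, VectorField.mlieBracket I T Y y = 0)
    {γ : ℝ → M} (hγ : IsMIntegralCurve γ Y) (hγO : ∀ s, γ s ∈ O) {c : ℝ}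
    (h0 : g.val (γ 0) (T (γ 0)) (T (γ 0)) = c) (s : ℝ) :
    γ s ∈ {y | g.val y (T y) (T y) = c} := by
  rw [mem_setOf_eq, hY.val_self_self_apply_eq_of_isMIntegralCurve hT hO hTY hγ hγO s, h0]

/-- **Components of the `T`-timelike part of `O` are invariant.** Let `A = {y ∈ O | g(T,T)(y) < 0}`.
An integral curve of `Y` inside `O` starting in `A` stays in the connected component of `A`
containing its starting point (the curve is continuous with values in `A`). [folklore] -/
theorem IsKillingFieldOn.mem_connectedComponentIn_of_isMIntegralCurve (hT : g.IsKillingField T)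
    (hY : g.IsKillingFieldOn Y O) (hO : IsOpen O) (hTY : ∀ y ∈ O, VectorField.mlieBracket I T Y y = 0)
    {γ : ℝ → M} (hγ : IsMIntegralCurve γ Y) (hγO : ∀ s, γ s ∈ O)
    (h0 : g.val (γ 0) (T (γ 0)) (T (γ 0)) < 0) (s : ℝ) :
    γ s ∈ connectedComponentIn {y | y ∈ O ∧ g.val y (T y) (T y) < 0} (γ 0) := by
  have hA : ∀ u, γ u ∈ {y | y ∈ O ∧ g.val y (T y) (T y) < 0} := fun u ↦
    ⟨hγO u, hY.val_self_self_neg_of_isMIntegralCurve hT hO hTY hγ hγO h0 u⟩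
  have hcont : Continuous γ := hγ.continuous
  have himg : IsPreconnected (range γ) := isPreconnected_range hcont
  exact (himg.subset_connectedComponentIn (mem_range_self 0) (range_subset_iff.2 hA))
    (mem_range_self s)

end PseudoRiemannianMetric

end Literature.Geometry.Lorentzian

end
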